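import Summits.BirchSwinnertonDyer.BirchSwinnertonDyer.Theorems.Rank2ObservatoryRootNumberCert
import Literature.NumberTheory.DiophantineGeometry.Conductor
import HarnessLib

/-!
# BSD rank ≥ 2 observatory (`b2b-bsdr2`): CONDUCTOR certificates read off the root-number
# certificates (tame case), modulo the tree's named facts on conductor exponents

HONEST FRAMING: per-curve certified theorems and census instruments; no claim on BSD in rank ≥ 2.

A checking root-number certificate `c : RNCert` of an integer equation `W₀` (file
`Rank2ObservatoryRootNumberCert`) already certifies the factorisation `|Δ| = 2^{k2} ∏ pᵉ`, the
reduction type at every odd bad prime (multiplicative with `p ∤ c₄`, or additive with `p ≥ 5`, by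
exact valuations) and `3 ∤ Δ ∨ 3 ∤ c₄`.  If moreover the equation is TAME AT `2` — `2 ∤ Δ` (good) or
`2 ∤ c₄` (multiplicative), `RNCert.tame` — then every conductor exponent is determined by the
reduction type alone (`f = 0, 1, 2` for good, multiplicative, additive with `p ≥ 5`), so the conductor
is the explicit number `RNCert.conductor c = 2^{[2 ∣ Δ]} · ∏ p^{1 or 2}`.

Main result: `conductorNorm_eq_conductor` —
`(W₀ ⊗ ℚ).conductorNorm ℤ = c.conductor` GIVEN, as hypotheses BY NAME, the tree's five NAMED FACTS on
conductor exponents (stated in `Literature.NumberTheory.DiophantineGeometry.Conductor`, not proved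
there): `conductorExponent_eq_zero_iff` / `_eq_one_iff` / `two_le_conductorExponent_iff`
(`f_v = 0, 1, ≥ 2` iff good, multiplicative, additive; Silverman *ATAEC* IV.10.2),
`conductorExponent_le_two_of_five_le_natGenerator` (`f_p ≤ 2` for `p ≥ 5`, IV.10.4) and
`factorization_conductorNorm` (`N_E = ∏ p^{f_p}`, *AEC* C.16). The reduction types themselves are
PROVED from the certificate (Silverman *AEC* VII.1.1, VII.5.1, via `Rank2ObservatoryRootNumberLocal`). Used by `Rank2ObservatoryRank3ConductorCensus` to discharge the
hypothesis `hN : conductorNorm ℤ = N` of the rank-3 census theorems for the tame rows.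

References: J. H. Silverman, *Advanced Topics in the Arithmetic of Elliptic Curves* (1994), IV.10
[Silverman1994]; *AEC* 2nd ed. (2009), VII.1, VII.5, C.16 [SilvermanAEC2009]; A. P. Ogg, *Elliptic
curves and wild ramification* (1967) [Ogg1967].
-/

set_option linter.dupNamespace false
set_option autoImplicit false

noncomputable section

open IsDedekindDomain Rat.HeightOneSpectrum WeierstrassCurve

namespace Summit.BirchSwinnertonDyer.BirchSwinnertonDyer.Rank2Observatory.RootNumber

/-! ### The conductor read off a root-number certificate -/

/-- Tameness at `2` of the equation, read off the certificate: `2 ∤ Δ` (`k2 = 0`, good reduction) or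
`2 ∤ c₄` (`k4 = 0`, `c₄ ≠ 0`: multiplicative reduction). [cite: SilvermanAEC2009, VII.5 Prop. 5.1] -/
def RNCert.tame (W₀ : WeierstrassCurve ℤ) (c : RNCert) : Bool :=
  decide (c.k2 = 0) || (decide (c.k4 = 0) && decide (W₀.c₄ ≠ 0))

/-- The conductor exponent certified by an entry: `1` (multiplicative, `kind = 0, 1`) or `2`
(additive, `p ≥ 5`). [cite: Silverman1994, IV.10.2] -/
def OddEntry.condExp (E : OddEntry) : ℕ :=
  if E.kind = 0 then 1 else if E.kind = 1 then 1 else 2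

/-- The certified conductor `2^{[k2 ≠ 0]} · ∏ p ^ condExp`. [cite: Silverman1994, IV.10.2] -/
def RNCert.conductor (c : RNCert) : ℕ :=
  (if c.k2 = 0 then 1 else 2) * (c.odd.map fun E => E.p ^ E.condExp).prod

section Arith

/-- Exponent of a prime `p` in a product `∏ qᵏ` over a list of entries with prime `q`:
the sum of the exponents of the entries at `p`. [folklore] -/
theorem factorization_prod_map_pow (g : OddEntry → ℕ) :
    ∀ (L : List OddEntry), (∀ E ∈ L, E.p.Prime) → ∀ p : ℕ,
      (L.map fun E => E.p ^ g E).prod.factorization p =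
        (L.map fun E => if E.p = p then g E else 0).sum
  | [], _, p => by simp
  | E :: L, hL, p => by
    have hE : E.p.Prime := hL E (by simp)
    have hL' : ∀ E' ∈ L, E'.p.Prime := fun E' h ↦ hL E' (by simp [h])
    have hne : (L.map fun E => E.p ^ g E).prod ≠ 0 := by
      rw [Ne, List.prod_eq_zero_iff, List.mem_map]
      rintro ⟨E', hE', h0⟩
      exact pow_ne_zero _ (hL' E' hE').ne_zero h0
    rw [List.map_cons, List.prod_cons, Nat.factorization_mul (pow_ne_zero _ hE.ne_zero) hne,
      Finsupp.add_apply, factorization_prod_map_pow g L hL' p, Nat.factorization_pow, List.map_cons,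
      List.sum_cons, Finsupp.smul_apply, hE.factorization, Finsupp.single_apply]
    split_ifs <;> simp

/-- In such a sum, if no entry has prime `p` the sum vanishes. [folklore] -/
theorem sum_ite_eq_zero (g : OddEntry → ℕ) (L : List OddEntry) (p : ℕ)
    (h : ∀ E ∈ L, E.p ≠ p) : (L.map fun E => if E.p = p then g E else 0).sum = 0 := by
  apply List.sum_eq_zero
  intro x hx
  obtain ⟨E, hE, rfl⟩ := List.mem_map.mp hx
  simp [h E hE]

/-- With distinct primes, the sum at the prime of a listed entry is that entry's exponent.
[folklore] -/
theorem sum_ite_eq_of_nodup (g : OddEntry → ℕ) :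
    ∀ (L : List OddEntry), (L.map OddEntry.p).Nodup → ∀ E ∈ L,
      (L.map fun E' => if E'.p = E.p then g E' else 0).sum = g E
  | [], _, E, hE => by simp at hE
  | E₀ :: L, hnd, E, hE => by
    rw [List.map_cons, List.nodup_cons] at hnd
    rcases List.mem_cons.mp hE with rfl | hE'
    · rw [List.map_cons, List.sum_cons, if_pos rfl, sum_ite_eq_zero g L _ fun E' hE' h ↦
        hnd.1 (List.mem_map.mpr ⟨E', hE', h⟩), add_zero]
    · have hne : E₀.p ≠ E.p := fun h ↦ hnd.1 (List.mem_map.mpr ⟨E, hE', h.symm⟩)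
      rw [List.map_cons, List.sum_cons, if_neg hne, zero_add, sum_ite_eq_of_nodup g L hnd.2 E hE']

end Arith

section IntModel

variable {W₀ : WeierstrassCurve ℤ} {c : RNCert}

/-- **Additive reduction from the certificate data at `p`**: `pⁿ ∥ Δ` with `n ≥ 1`, `p ∣ c₄`, and
`n < 12` or `p⁴ ∤ c₄` (so the equation is minimal at `p`, Silverman *AEC* VII.1 Rem. 1.1; then
VII.5.1(c)). [cite: SilvermanAEC2009, VII.5 Prop. 5.1(c)] -/
theorem hasAdditiveReductionAt_of_dvd (v : HeightOneSpectrum ℤ) [(W₀.baseChange ℚ).IsElliptic]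
    {n : ℕ} (hn₁ : 1 ≤ n) (hΔ : (natGenerator v : ℤ) ^ n ∣ W₀.Δ)
    (hΔ' : ¬ (natGenerator v : ℤ) ^ (n + 1) ∣ W₀.Δ)
    (hmin' : n < 12 ∨ ¬ (natGenerator v : ℤ) ^ 4 ∣ W₀.c₄) (hc₄ : (natGenerator v : ℤ) ∣ W₀.c₄) :
    (W₀.baseChange ℚ).HasAdditiveReductionAt v := by
  have hmin : (W₀.baseChange ℚ).IsMinimalAt v := by
    rcases hmin' with hn | h4
    · exact isMinimalAt_baseChange_int_of_not_pow_dvd_Δ fun h ↦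
        hΔ' (dvd_trans (pow_dvd_pow _ (by omega)) h)
    · exact isMinimalAt_of_lt_valuation_c₄ (isIntegralAt_baseChange_int v W₀)
        (by rw [baseChange_int_c₄]
            exact (Literature.NumberTheory.EllipticCurves.Rat.exp_lt_valuation_intCast_iff v _ 4).mpr h4)
  rw [hasAdditiveReductionAt_iff_of_isMinimalAt hmin, baseChange_int_Δ, baseChange_int_c₄,
    Literature.NumberTheory.EllipticCurves.Rat.valuation_intCast_lt_one_iff,
    Literature.NumberTheory.EllipticCurves.Rat.valuation_intCast_lt_one_iff]
  exact ⟨dvd_trans (dvd_pow_self _ (by omega)) hΔ, hc₄⟩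

/-- A listed prime divides `Δ` (its exponent is `≥ 1` in the certified factorisation). [folklore] -/
theorem dvd_Δ_of_mem (hc : c.check W₀ = true) {E : OddEntry} (hE : E ∈ c.odd) :
    (E.p : ℤ) ∣ W₀.Δ := by
  obtain ⟨-, -, -, -, hall, hfac⟩ := RNCert.check_spec hc
  have he : 1 ≤ E.e := (OddEntry.check_spec (hall E hE)).2.2.1
  rw [Int.natCast_dvd, hfac]
  exact dvd_mul_of_dvd_right (dvd_trans (dvd_pow_self _ (by omega))
    (List.dvd_prod (List.mem_map.mpr ⟨E, hE, rfl⟩))) _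

/-- The certified conductor is non-zero. [folklore] -/
theorem conductor_ne_zero (hc : c.check W₀ = true) : c.conductor ≠ 0 := by
  obtain ⟨-, -, -, -, hall, -⟩ := RNCert.check_spec hc
  have hne : (c.odd.map fun E => E.p ^ E.condExp).prod ≠ 0 := by
    rw [Ne, List.prod_eq_zero_iff, List.mem_map]
    rintro ⟨E, hE, h0⟩
    exact pow_ne_zero _ (OddEntry.check_spec (hall E hE)).1.ne_zero h0
  unfold RNCert.conductor
  split_ifs <;> simp [hne]

/-- **The conductor exponent at a place, from the certificate**: `f_v` equals the certified exponent
at `p = natGenerator v` — `0` off the bad primes, `[k2 ≠ 0]` at `2` (tame case), `condExp` at a listed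
odd prime. [cite: Silverman1994, IV.10.2 and IV.10.4] -/
theorem conductorExponent_eq_of_check (hc : c.check W₀ = true) (ht : c.tame W₀ = true)
    (h0 : ∀ v : HeightOneSpectrum ℤ, conductorExponent_eq_zero_iff v (W₀.baseChange ℚ))
    (h1 : ∀ v : HeightOneSpectrum ℤ, conductorExponent_eq_one_iff v (W₀.baseChange ℚ))
    (h2 : ∀ v : HeightOneSpectrum ℤ, two_le_conductorExponent_iff v (W₀.baseChange ℚ))
    (h5 : ∀ v : HeightOneSpectrum ℤ,
      conductorExponent_le_two_of_five_le_natGenerator (W₀.baseChange ℚ) v)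
    (v : HeightOneSpectrum ℤ) :
    (W₀.baseChange ℚ).conductorExponent v =
      (if natGenerator v = 2 then (if c.k2 = 0 then 0 else 1) else 0) +
        (c.odd.map fun E => if E.p = natGenerator v then E.condExp else 0).sum := by
  haveI := isElliptic_of_check hc
  obtain ⟨hk2, hk4, -, hnd, hall, -⟩ := RNCert.check_spec hc
  have e0 : (W₀.baseChange ℚ).conductorExponent v = 0 ↔ (W₀.baseChange ℚ).HasGoodReductionAt v :=
    h0 v
  have e1 : (W₀.baseChange ℚ).conductorExponent v = 1 ↔
      (W₀.baseChange ℚ).HasMultiplicativeReductionAt v := h1 v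
  have e2 : 2 ≤ (W₀.baseChange ℚ).conductorExponent v ↔
      (W₀.baseChange ℚ).HasAdditiveReductionAt v := h2 v
  have e5 : 5 ≤ natGenerator v → (W₀.baseChange ℚ).conductorExponent v ≤ 2 := h5 v
  have hp : (natGenerator v).Prime := prime_natGenerator v
  simp only [RNCert.tame, Bool.or_eq_true, Bool.and_eq_true, decide_eq_true_eq] at ht
  by_cases hv2 : natGenerator v = 2
  · -- the place of `2`: no odd entry has prime `2`
    have hsum : (c.odd.map fun E => if E.p = natGenerator v then E.condExp else 0).sum = 0 :=
      sum_ite_eq_zero _ _ _ fun E hE ↦ hv2 ▸ (OddEntry.check_spec (hall E hE)).2.1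
    rw [hsum, add_zero, if_pos hv2]
    by_cases hk : c.k2 = 0
    · -- `2 ∤ Δ`: good reduction
      rw [if_pos hk]
      refine e0.mpr (hasGoodReductionAt_of_not_dvd ?_)
      rw [hv2]
      have := (exactPow_spec hk2).2
      rw [hk, zero_add, pow_one] at this
      exact_mod_cast this
    · -- `2 ∣ Δ`, `2 ∤ c₄`: multiplicative reduction
      rw [if_neg hk]
      rcases ht with h | ⟨h4, hc0⟩
      · exact absurd h hk
      have hc4 : ¬ (2 : ℤ) ∣ W₀.c₄ := by
        have := (exactPow_spec (hk4.resolve_left hc0)).2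
        rw [h4, zero_add, pow_one] at this
        exact_mod_cast this
      have hΔ : (2 : ℤ) ∣ W₀.Δ :=
        dvd_trans (by exact_mod_cast dvd_pow_self (2 : ℤ) hk) (exactPow_spec hk2).1
      exact e1.mpr (hasMultiplicativeReductionAt_of_dvd_of_not_dvd (by rw [hv2]; exact_mod_cast hΔ)
        (by rw [hv2]; exact_mod_cast hc4))
  · rw [if_neg hv2, zero_add]
    by_cases hmem : natGenerator v ∈ c.odd.map OddEntry.p
    · -- a listed odd prime
      obtain ⟨E, hE, hEp⟩ := List.mem_map.mp hmem
      rw [← hEp, sum_ite_eq_of_nodup _ _ hnd E hE]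
      obtain ⟨-, -, he, hk0, hk1, hk2'⟩ := OddEntry.check_spec (hall E hE)
      have hΔ : (natGenerator v : ℤ) ∣ W₀.Δ := hEp ▸ dvd_Δ_of_mem hc hE
      by_cases hK0 : E.kind = 0
      · rw [OddEntry.condExp, if_pos hK0]
        exact e1.mpr (hasMultiplicativeReductionAt_of_dvd_of_not_dvd hΔ (hEp ▸ (hk0 hK0).1))
      by_cases hK1 : E.kind = 1
      · rw [OddEntry.condExp, if_neg hK0, if_pos hK1]
        exact e1.mpr (hasMultiplicativeReductionAt_of_dvd_of_not_dvd hΔ (hEp ▸ (hk1 hK1).1))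
      · rw [OddEntry.condExp, if_neg hK0, if_neg hK1]
        obtain ⟨h5p, heΔ, hc₄, htc, hmin⟩ := hk2' hK0 hK1
        refine le_antisymm (e5 (hEp ▸ h5p)) (e2.mpr ?_)
        refine hasAdditiveReductionAt_of_dvd v he (hEp ▸ (exactPow_spec heΔ).1)
          (hEp ▸ (exactPow_spec heΔ).2) ?_ (hEp ▸ hc₄)
        rcases hmin with h | h
        · exact Or.inl h
        · right
          rw [← hEp]
          exact fun h4 ↦ (exactPow_spec htc).2 (dvd_trans (pow_dvd_pow _ (by omega)) h4)
    · -- off the bad primes: good reduction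
      rw [sum_ite_eq_zero _ _ _ fun E hE h ↦ hmem (List.mem_map.mpr ⟨E, hE, h⟩)]
      refine e0.mpr (hasGoodReductionAt_of_not_dvd fun hdvd ↦ ?_)
      rcases List.mem_cons.mp (mem_of_prime_dvd hc hp hdvd) with h | h
      · exact hv2 h
      · exact hmem h

/-- **The conductor from the certificate** (tame case), modulo the named facts:
`N (W₀ ⊗ ℚ) = c.conductor`. [cite: Silverman1994, IV.10.2 and IV.10.4]
[cite: SilvermanAEC2009, C.16] -/
theorem conductorNorm_eq_conductor (hc : c.check W₀ = true) (ht : c.tame W₀ = true)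
    (h0 : ∀ v : HeightOneSpectrum ℤ, conductorExponent_eq_zero_iff v (W₀.baseChange ℚ))
    (h1 : ∀ v : HeightOneSpectrum ℤ, conductorExponent_eq_one_iff v (W₀.baseChange ℚ))
    (h2 : ∀ v : HeightOneSpectrum ℤ, two_le_conductorExponent_iff v (W₀.baseChange ℚ))
    (h5 : ∀ v : HeightOneSpectrum ℤ,
      conductorExponent_le_two_of_five_le_natGenerator (W₀.baseChange ℚ) v)
    (hf : ∀ v : HeightOneSpectrum ℤ, factorization_conductorNorm (W₀.baseChange ℚ) v) :
    (W₀.baseChange ℚ).conductorNorm ℤ = c.conductor := by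
  haveI := isElliptic_of_check hc
  obtain ⟨-, -, -, -, hall, -⟩ := RNCert.check_spec hc
  have hprime : ∀ E ∈ c.odd, E.p.Prime := fun E hE ↦ (OddEntry.check_spec (hall E hE)).1
  refine Nat.eq_of_factorization_eq
    (conductorNorm_pos_holds (W₀.baseChange ℚ) : 0 < (W₀.baseChange ℚ).conductorNorm ℤ).ne'
    (conductor_ne_zero hc) fun p ↦ ?_
  by_cases hp : p.Prime
  · have hfac : ((W₀.baseChange ℚ).conductorNorm ℤ).factorization (natGenerator (natPlace p)) =
        (W₀.baseChange ℚ).conductorExponent (natPlace p) := hf (natPlace p)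
    rw [natGenerator_natPlace hp] at hfac
    rw [hfac, conductorExponent_eq_of_check hc ht h0 h1 h2 h5 (natPlace p), natGenerator_natPlace hp,
      RNCert.conductor, Nat.factorization_mul (by split_ifs <;> decide) (by
        rw [Ne, List.prod_eq_zero_iff, List.mem_map]
        rintro ⟨E, hE, h0⟩
        exact pow_ne_zero _ (hprime E hE).ne_zero h0),
      Finsupp.add_apply, factorization_prod_map_pow OddEntry.condExp c.odd hprime p]
    congr 1
    by_cases hp2 : p = 2
    · subst hp2
      by_cases hk : c.k2 = 0
      · rw [if_pos rfl, if_pos hk, if_pos hk, Nat.factorization_one, Finsupp.zero_apply]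
      · rw [if_pos rfl, if_neg hk, if_neg hk, Nat.prime_two.factorization_self]
    · by_cases hk : c.k2 = 0
      · rw [if_neg hp2, if_pos hk, Nat.factorization_one, Finsupp.zero_apply]
      · rw [if_neg hp2, if_neg hk, Nat.prime_two.factorization, Finsupp.single_apply,
          if_neg (Ne.symm hp2)]
  · rw [Nat.factorization_eq_zero_of_not_prime _ hp, Nat.factorization_eq_zero_of_not_prime _ hp]

end IntModel

/-- Self-test: the certificate of `5077a1` is tame with conductor `5077` (kernel).
[cite: CremonaAlgorithms1997, Tables] -/
example : RNCert.tame ⟨0, 0, 1, -7, 6⟩ ⟨0, 4, 3, [⟨5077, 71, 1, 0, 0⟩]⟩ = true ∧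
    RNCert.conductor ⟨0, 4, 3, [⟨5077, 71, 1, 0, 0⟩]⟩ = 5077 := by decide +kernel

end Summit.BirchSwinnertonDyer.BirchSwinnertonDyer.Rank2Observatory.RootNumber
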